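import Mathlib.Analysis.SpecialFunctions.Log.Basic
import Mathlib.Data.Nat.Log
import Mathlib.Data.Fintype.BigOperators
import Mathlib.Tactic.IntervalCases
import Literature.Computability.Complexity.CircuitLightCone
import Literature.Computability.QuantumComplexity.ShallowCircuitsRectangle
import HarnessLib

/-!
# Proof of the classical depth lower bound for 2D HLF (Bravyi–Gosset–König, Theorem 2)

Trunk `CryptoQuantFine` / family `quantum-advantage`. This file discharges the named fact
`hlf_classical_depth_lower_bound` of `ShallowCircuits.lean`:
any classical probabilistic circuit of fan-in `≤ 2` gates that solves the 2D Hidden Linear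
Function problem on the `N × N` grid with probability `> 7/8` on every instance has depth
`≥ ½ log N` for `N ≥ 2³⁰` (Bravyi–Gosset–König, *Quantum advantage with shallow circuits*,
Science 362 (2018), arXiv:1704.00690, Theorem 2 and §4.2).

## Proof architecture (BGK §4, with the simplifications recorded in the sibling files)

* `Circuit.card_lightCone_le_two_pow` (`CircuitLightCone`): an output of depth `d` reads at most
  `2^d` input bits (BGK Eq. (2)).
* `exists_hubs` (this file, BGK Claims 5–6): if `2¹¹ · 2^d ≤ N/8`, double counting produces three
  hubs `u, v, w` with even coordinates in the top, right and bottom strips of the grid such that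
  the outputs on the row of `u` and on column `0` do not read `b_v, b_w`, the outputs on the
  column of `v` do not read `b_u, b_w`, and the outputs on the row of `w` do not read `b_u, b_v`.
* `RectData.exists_of_hubs` (`ShallowCircuitsRectangle`, replacing BGK Claim 7): the boundary of
  the rectangle with these rows/columns is an even cycle `Γ` through `u, v, w`.
* `necklace_game_lost` (this file): on the `8` instances `(A_Γ, b = β 1_{u,v,w})` (BGK Eq. (31))
  every output on `Γ` then depends on at most the bit of "its" hub, so by
  `Necklace.gameOK` (BGK Claim 3, `ShallowCircuitsNecklace`) and `game_unwinnable` (BGK Lemma 3,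
  `ShallowCircuitsGame`) some instance is answered incorrectly — for every fixed random string.
* `exists_coins_forall`: success probability `> 7/8` on each of `8` instances forces a common
  good random string (union bound), a contradiction. Hence `2¹¹ · 2^d > N/8`, i.e.
  `d ≥ log₂ N - 14 ≥ ½ log N` for `N ≥ 2³⁰`.

## References

* S. Bravyi, D. Gosset, R. König, *Quantum advantage with shallow circuits*, Science 362 (2018)
  308–311, arXiv:1704.00690, Theorem 2, §2 (Eq. (2)), §4.1 (Lemma 3, Claim 3), §4.2 (Claims 5–7,
  Eq. (22)–(23), Eq. (31)). Section, claim and equation numbers are those of arXiv:1704.00690v1.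
-/

namespace Literature.Computability.QuantumComplexity

open Finset Complexity

/-! ### The game on a necklace with zones -/

section Core

variable {N r m : ℕ} [NeZero m]

/-- **Local circuits lose the necklace game** (Bravyi–Gosset–König 2018, §4.2, the final
contradiction, for a fixed random string). Let `Γ` be a necklace with a zone map assigning to
each position a hub, never the hub opposite to the triangle side of an odd position. If for
every position `p` the output circuit at `Γ p` does not read the bits `b_{hub a}` for
`a ≠ zone p`, then for some setting `β` the outputs on the instance `(A_Γ, β)` are not a
solution. [cite: BravyiGossetKonigScience2018, §4.2 Claim 7] -/
theorem necklace_game_lost (Γ : Necklace N m) (zone : Fin m × Bool → Fin 3)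
    (hzone : ∀ t, zone (t, true) ≠ Γ.arcOf t)
    (Cs : Fin N × Fin N → Circuit (Fin (inLen N + r))) (ρ : Fin r → Bool)
    (havoid : ∀ p a, a ≠ zone p →
      bIdx N r (Γ.toFun (Γ.hub a, false)) ∉ (Cs (Γ.toFun p)).lightCone) :
    ∃ β, (fun v => (Cs v).eval (Fin.append (encodeHLF (Γ.hlfInstance β)) ρ)) ∉ hlfSolutions (Γ.hlfInstance β) := by
  by_contra h
  push Not at h
  refine game_unwinnable Γ.cls zone
    (fun β p => (Cs (Γ.toFun p)).eval (Fin.append (encodeHLF (Γ.hlfInstance β)) ρ)) ?_ ?_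
    (fun β => Γ.gameOK β (h β))
  · intro β β' p hp
    apply Circuit.eval_congr_lightCone
    intro i hi
    apply necklace_input_congr
    intro a ha heq
    subst heq
    exact havoid p a (fun e => ha (by rw [e]; exact hp)) hi
  · rintro ⟨t, b⟩ a hc
    cases b
    · simp [Necklace.cls] at hc
    · simp only [Necklace.cls, if_true, Option.some.injEq] at hc
      rw [← hc]
      exact hzone t

end Core

/-! ### A common good random string (union bound) -/

/-- **Union bound over the settings.** If each of the events `E i`, `i : ι`, has probability
`> 1 - 1/|ι|` under the uniform distribution on `r` random bits, some string of `r` bits lies in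
all of them. (Bravyi–Gosset–König 2018, §4.1, proof of Lemma 3, the averaging step
`(1/8) Σ_b Prob_ρ[F(b, r) ∈ 𝒯(b)] ≤ 7/8`, read contrapositively.) [cite: BravyiGossetKonigScience2018, §4.1 Lemma 3] -/
theorem exists_coins_forall {r : ℕ} {ι : Type*} [Fintype ι] (E : ι → Set (List Bool))
    (h : ∀ i, (1 - 1 / Fintype.card ι : ℝ) < uniformProb r (E i)) :
    ∃ ρ : List.Vector Bool r, ∀ i, ρ.toList ∈ E i := by
  classical
  rcases isEmpty_or_nonempty ι with hι | hι
  · exact ⟨⟨List.replicate r false, by simp⟩, fun i => (IsEmpty.false i).elim⟩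
  have hpos : (0 : ℝ) < Fintype.card ι := by exact_mod_cast Fintype.card_pos
  set bad : ι → Finset (List.Vector Bool r) := fun i => univ.filter fun ρ => ρ.toList ∉ E i
    with hbad
  have hcard : ∀ i, ((bad i).card : ℝ) * Fintype.card ι < 2 ^ r := by
    intro i
    have hi := h i
    unfold uniformProb at hi
    have hsum : ((univ.filter fun ρ : List.Vector Bool r => ρ.toList ∈ E i).card : ℝ) +
        (bad i).card = 2 ^ r := by
      rw [hbad]
      norm_cast
      rw [Finset.card_filter_add_card_filter_not, card_univ, card_vector, Fintype.card_bool]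
    rw [lt_div_iff₀ (by positivity)] at hi
    have h1 := mul_lt_mul_of_pos_right hi hpos
    have hk : (1 - 1 / (Fintype.card ι : ℝ)) * 2 ^ r * Fintype.card ι =
        2 ^ r * Fintype.card ι - 2 ^ r := by
      field_simp
    rw [hk] at h1
    nlinarith [hsum, h1]
  have htot : ((univ : Finset ι).biUnion bad).card < (univ : Finset (List.Vector Bool r)).card := by
    have h1 : ((((univ : Finset ι).biUnion bad).card : ℕ) : ℝ) ≤ ∑ i, ((bad i).card : ℝ) := by
      exact_mod_cast card_biUnion_le
    have h2 : (∑ i, ((bad i).card : ℝ)) * Fintype.card ι < ∑ _i : ι, (2 : ℝ) ^ r := by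
      rw [sum_mul]
      exact sum_lt_sum_of_nonempty univ_nonempty fun i _ => hcard i
    rw [sum_const, card_univ, nsmul_eq_mul] at h2
    have h3 : (∑ i, ((bad i).card : ℝ)) < 2 ^ r := by
      by_contra hc
      push Not at hc
      have := mul_le_mul_of_nonneg_right hc hpos.le
      linarith [mul_comm (2 ^ r : ℝ) (Fintype.card ι : ℝ)]
    have h4 : ((((univ : Finset ι).biUnion bad).card : ℕ) : ℝ) < 2 ^ r := h1.trans_lt h3
    rw [card_univ, card_vector, Fintype.card_bool]
    exact_mod_cast h4
  obtain ⟨ρ, -, hρ⟩ := exists_mem_notMem_of_card_lt_card htot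
  refine ⟨ρ, fun i => ?_⟩
  by_contra hni
  exact hρ (mem_biUnion.mpr ⟨i, mem_univ _, by simp [hbad, hni]⟩)

/-! ### Choosing the hubs (BGK Claims 5 and 6) -/

section Counting

variable {N : ℕ}

/-- Outputs on a line of `≤ N` vertices read at most `N · T` hub bits in total. [folklore] -/
theorem card_biUnion_line_le (LCb : Fin N × Fin N → Finset (Fin N × Fin N)) {T : ℕ}
    (hT : ∀ j, (LCb j).card ≤ T) (L : Finset (Fin N × Fin N)) (hL : L.card ≤ N) :
    (L.biUnion LCb).card ≤ N * T :=
  calc (L.biUnion LCb).card ≤ ∑ j ∈ L, (LCb j).card := card_biUnion_le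
    _ ≤ ∑ _j ∈ L, T := sum_le_sum fun j _ => hT j
    _ = L.card * T := by rw [sum_const, smul_eq_mul]
    _ ≤ N * T := Nat.mul_le_mul_right _ hL

/-- A row of the grid has at most `N` vertices. [folklore] -/
theorem card_row_le (i : Fin N) : (univ.filter fun j : Fin N × Fin N => j.1 = i).card ≤ N := by
  calc (univ.filter fun j : Fin N × Fin N => j.1 = i).card ≤ (univ : Finset (Fin N)).card :=
        card_le_card_of_injOn (fun j => j.2) (fun _ _ => mem_coe.mpr (mem_univ _)) (by
          intro j hj j' hj' h
          simp only [coe_filter, mem_univ, true_and, Set.mem_setOf_eq] at hj hj'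
          exact Prod.ext (hj.trans hj'.symm) h)
    _ = N := by rw [card_univ, Fintype.card_fin]

/-- A column of the grid has at most `N` vertices. [folklore] -/
theorem card_col_le (i : Fin N) : (univ.filter fun j : Fin N × Fin N => j.2 = i).card ≤ N := by
  calc (univ.filter fun j : Fin N × Fin N => j.2 = i).card ≤ (univ : Finset (Fin N)).card :=
        card_le_card_of_injOn (fun j => j.1) (fun _ _ => mem_coe.mpr (mem_univ _)) (by
          intro j hj j' hj' h
          simp only [coe_filter, mem_univ, true_and, Set.mem_setOf_eq] at hj hj'
          exact Prod.ext h (hj.trans hj'.symm))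
    _ = N := by rw [card_univ, Fintype.card_fin]

/-- **Few hub bits have large forward cones** (Bravyi–Gosset–König 2018, Claim 5, double
counting the pairs (output `z_j`, input `b_h ∈ L(z_j)`)): if every output reads at most `T`
hub bits, then `(S + 1) · #{h : #{j : b_h ∈ L(z_j)} > S} ≤ N² T`. [cite: BravyiGossetKonigScience2018, §4.2 Claim 5] -/
theorem card_bad_mul_le (LCb : Fin N × Fin N → Finset (Fin N × Fin N)) {T : ℕ}
    (hT : ∀ j, (LCb j).card ≤ T) (S : ℕ) :
    (S + 1) * (univ.filter fun h : Fin N × Fin N =>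
        S < (univ.filter fun j : Fin N × Fin N => h ∈ LCb j).card).card ≤ N * N * T := by
  set F : Fin N × Fin N → Finset (Fin N × Fin N) := fun h => univ.filter fun j => h ∈ LCb j
    with hF
  set Bad := univ.filter fun h => S < (F h).card with hBad
  calc (S + 1) * Bad.card = ∑ _h ∈ Bad, (S + 1) := by rw [sum_const, smul_eq_mul, mul_comm]
    _ ≤ ∑ h ∈ Bad, (F h).card := sum_le_sum fun h hh => (mem_filter.mp hh).2
    _ ≤ ∑ h, (F h).card :=
        sum_le_sum_of_subset_of_nonneg (subset_univ _) fun _ _ _ => Nat.zero_le _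
    _ = ∑ j, (LCb j).card := by
        simp only [hF, card_filter]
        rw [sum_comm]
        refine sum_congr rfl fun j _ => ?_
        rw [← sum_filter, filter_mem_eq_inter, univ_inter, card_eq_sum_ones]
    _ ≤ ∑ _j : Fin N × Fin N, T := sum_le_sum fun j _ => hT j
    _ = N * N * T := by rw [sum_const, card_univ, Fintype.card_prod, Fintype.card_fin, smul_eq_mul]

/-- **Choice of the hubs** (Bravyi–Gosset–König 2018, Claims 5–6, in the rectangle geometry).
Write `n = ⌊N/8⌋` and suppose every output reads at most `T ≥ 1` hub bits, `2¹¹ T ≤ n`. Then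
there are vertices `u, v, w` with even coordinates, `u` in rows `< 2n` and columns `[2n, 6n)`,
`v` in rows `[2n, 6n)` and columns `≥ 6n`, `w` in rows `≥ 6n` and columns `[2n, 6n)`, such
that no output on the row of `u` or on column `0` reads `b_v` or `b_w`, no output on the column
of `v` reads `b_u` or `b_w`, and no output on the row of `w` reads `b_u` or `b_v`. [cite: BravyiGossetKonigScience2018, §4.2 Claim 6] -/
theorem exists_hubs (LCb : Fin N × Fin N → Finset (Fin N × Fin N)) {T : ℕ}
    (hT : ∀ j, (LCb j).card ≤ T) (hTpos : 0 < T) (hn : 2048 * T ≤ N / 8) :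
    ∃ u v w : Fin N × Fin N,
      (u.1.val < 2 * (N / 8) ∧ 2 * (N / 8) ≤ u.2.val ∧ u.2.val < 6 * (N / 8) ∧
        u.1.val % 2 = 0 ∧ u.2.val % 2 = 0) ∧
      (2 * (N / 8) ≤ v.1.val ∧ v.1.val < 6 * (N / 8) ∧ 6 * (N / 8) ≤ v.2.val ∧
        v.1.val % 2 = 0 ∧ v.2.val % 2 = 0) ∧
      (6 * (N / 8) ≤ w.1.val ∧ 2 * (N / 8) ≤ w.2.val ∧ w.2.val < 6 * (N / 8) ∧
        w.1.val % 2 = 0 ∧ w.2.val % 2 = 0) ∧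
      (∀ j, (j.1 = u.1 ∨ j.2.val = 0) → v ∉ LCb j ∧ w ∉ LCb j) ∧
      (∀ j, j.2 = v.2 → u ∉ LCb j ∧ w ∉ LCb j) ∧
      (∀ j, j.1 = w.1 → u ∉ LCb j ∧ v ∉ LCb j) := by
  classical
  -- parameters
  set n := N / 8 with hn_def
  have h8 : 8 * n ≤ N := by rw [hn_def]; exact Nat.mul_div_le N 8
  have hnT : 2048 * T ≤ n := hn
  have hnpos : 0 < n := by omega
  have hN16 : N ≤ 16 * n := by omega
  have hN0 : 0 < N := by omega
  set S := n / 4 with hS_def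
  have hS4 : 4 * S ≤ n := by omega
  have hS1 : n ≤ 4 * (S + 1) := by omega
  -- forward cones and bad hub bits
  set F : Fin N × Fin N → Finset (Fin N × Fin N) := fun h => univ.filter fun j => h ∈ LCb j
    with hF
  have memF : ∀ {h j}, h ∈ LCb j → j ∈ F h := fun hm => by simp [hF, hm]
  set Bad : Finset (Fin N × Fin N) := univ.filter fun h => S < (F h).card with hBad
  have hBad_card : Bad.card ≤ 1024 * n * T := by
    have h1 : (S + 1) * Bad.card ≤ N * N * T := card_bad_mul_le LCb hT S
    have h2 : N * N * T ≤ 16 * n * (16 * n) * T :=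
      Nat.mul_le_mul (Nat.mul_le_mul hN16 hN16) le_rfl
    have h3 : n * Bad.card ≤ n * (1024 * n * T) :=
      calc n * Bad.card ≤ 4 * (S + 1) * Bad.card := Nat.mul_le_mul_right _ hS1
        _ = 4 * ((S + 1) * Bad.card) := by ring
        _ ≤ 4 * (N * N * T) := Nat.mul_le_mul_left 4 h1
        _ ≤ 4 * (16 * n * (16 * n) * T) := Nat.mul_le_mul_left 4 h2
        _ = n * (1024 * n * T) := by ring
    exact Nat.le_of_mul_le_mul_left h3 hnpos
  have notBad : ∀ {h}, h ∉ Bad → (F h).card ≤ S := fun hh => by simpa [hBad] using hh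
  -- hub bits read on a line
  set Urow : Fin N → Finset (Fin N × Fin N) :=
    fun i => (univ.filter fun j : Fin N × Fin N => j.1 = i).biUnion LCb with hUrow
  set Ucol : Fin N → Finset (Fin N × Fin N) :=
    fun i => (univ.filter fun j : Fin N × Fin N => j.2 = i).biUnion LCb with hUcol
  have hUrow_card : ∀ i, (Urow i).card ≤ 16 * n * T := fun i =>
    (card_biUnion_line_le LCb hT _ (card_row_le i)).trans (Nat.mul_le_mul_right _ hN16)
  have hUcol_card : ∀ i, (Ucol i).card ≤ 16 * n * T := fun i =>
    (card_biUnion_line_le LCb hT _ (card_col_le i)).trans (Nat.mul_le_mul_right _ hN16)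
  have notUrow : ∀ {i h}, h ∉ Urow i → ∀ j : Fin N × Fin N, j.1 = i → h ∉ LCb j := by
    intro i h hh j hj hm
    exact hh (mem_biUnion.mpr ⟨j, by simp [hj], hm⟩)
  have notUcol : ∀ {i h}, h ∉ Ucol i → ∀ j : Fin N × Fin N, j.2 = i → h ∉ LCb j := by
    intro i h hh j hj hm
    exact hh (mem_biUnion.mpr ⟨j, by simp [hj], hm⟩)
  let c0 : Fin N := ⟨0, hN0⟩
  -- even coordinates in the three strips
  let lo : Fin n → Fin N := fun i => ⟨2 * i.val, by have := i.isLt; omega⟩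
  let mid : Fin (2 * n) → Fin N := fun i => ⟨2 * n + 2 * i.val, by have := i.isLt; omega⟩
  let hi : Fin n → Fin N := fun i => ⟨6 * n + 2 * i.val, by have := i.isLt; omega⟩
  have lo_inj : Function.Injective lo := fun i i' e => by
    simp only [lo, Fin.mk.injEq] at e; exact Fin.ext (by omega)
  have mid_inj : Function.Injective mid := fun i i' e => by
    simp only [mid, Fin.mk.injEq] at e; exact Fin.ext (by omega)
  have hi_inj : Function.Injective hi := fun i i' e => by
    simp only [hi, Fin.mk.injEq] at e; exact Fin.ext (by omega)
  -- generic transfer of cardinalities along injections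
  have cnt : ∀ {α : Type} [Fintype α] (e : α → Fin N × Fin N), Function.Injective e →
      ∀ X : Finset (Fin N × Fin N), (univ.filter fun x => e x ∈ X).card ≤ X.card := by
    intro α _ e he X
    exact card_le_card_of_injOn e (fun x hx => by simpa using hx) he.injOn
  have cnt' : ∀ {k : ℕ} (e : Fin k → Fin N), Function.Injective e →
      ∀ X : Finset (Fin N), (univ.filter fun x => e x ∈ X).card ≤ X.card := by
    intro k e he X
    exact card_le_card_of_injOn e (fun x hx => by simpa using hx) he.injOn
  ---------------------------------------------------------------- Step 1: the hub `u`
  let eu : Fin n × Fin (2 * n) → Fin N × Fin N := fun x => (lo x.1, mid x.2)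
  have eu_inj : Function.Injective eu := fun x y e => by
    simp only [eu, Prod.mk.injEq] at e
    exact Prod.ext (lo_inj e.1) (mid_inj e.2)
  obtain ⟨xu, -, hxu⟩ : ∃ x ∈ (univ : Finset (Fin n × Fin (2 * n))),
      x ∉ univ.filter fun x => eu x ∈ Bad := by
    apply exists_mem_notMem_of_card_lt_card
    calc (univ.filter fun x => eu x ∈ Bad).card ≤ Bad.card := cnt eu eu_inj Bad
      _ ≤ 1024 * n * T := hBad_card
      _ = n * (1024 * T) := by ring
      _ < n * (2 * n) := Nat.mul_lt_mul_of_pos_left (by omega) hnpos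
      _ = (univ : Finset (Fin n × Fin (2 * n))).card := by simp
  have hu_bad : eu xu ∉ Bad := by simpa using hxu
  have hu_good : (F (eu xu)).card ≤ S := notBad hu_bad
  ---------------------------------------------------------------- Step 2: the hub `v`
  let ev : Fin (2 * n) × Fin n → Fin N × Fin N := fun x => (mid x.1, hi x.2)
  have ev_inj : Function.Injective ev := fun x y e => by
    simp only [ev, Prod.mk.injEq] at e
    exact Prod.ext (mid_inj e.1) (hi_inj e.2)
  set Xv : Finset (Fin (2 * n) × Fin n) :=
    univ.filter fun x => ev x ∈ Bad ∪ Urow (eu xu).1 ∪ Ucol c0 with hXv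
  set Yv : Finset (Fin (2 * n) × Fin n) :=
    univ.filter fun x => hi x.2 ∈ (F (eu xu)).image Prod.snd with hYv
  have hXv_card : Xv.card ≤ n * (1056 * T) :=
    calc Xv.card ≤ (Bad ∪ Urow (eu xu).1 ∪ Ucol c0).card := cnt ev ev_inj _
      _ ≤ Bad.card + (Urow (eu xu).1).card + (Ucol c0).card :=
          (card_union_le _ _).trans (Nat.add_le_add_right (card_union_le _ _) _)
      _ ≤ 1024 * n * T + 16 * n * T + 16 * n * T :=
          Nat.add_le_add (Nat.add_le_add hBad_card (hUrow_card _)) (hUcol_card _)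
      _ = n * (1056 * T) := by ring
  have hYv_card : Yv.card ≤ n * (2 * S) := by
    have hprod : Yv = (univ : Finset (Fin (2 * n))) ×ˢ
        (univ.filter fun j : Fin n => hi j ∈ (F (eu xu)).image Prod.snd) := by
      ext x
      simp [hYv]
    rw [hprod, card_product, card_univ, Fintype.card_fin]
    calc 2 * n * (univ.filter fun j : Fin n => hi j ∈ (F (eu xu)).image Prod.snd).card
        ≤ 2 * n * ((F (eu xu)).image Prod.snd).card := Nat.mul_le_mul_left _ (cnt' hi hi_inj _)
      _ ≤ 2 * n * (F (eu xu)).card := Nat.mul_le_mul_left _ card_image_le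
      _ ≤ 2 * n * S := Nat.mul_le_mul_left _ hu_good
      _ = n * (2 * S) := by ring
  obtain ⟨xv, -, hxv⟩ : ∃ x ∈ (univ : Finset (Fin (2 * n) × Fin n)), x ∉ Xv ∪ Yv := by
    apply exists_mem_notMem_of_card_lt_card
    calc (Xv ∪ Yv).card ≤ Xv.card + Yv.card := card_union_le _ _
      _ ≤ n * (1056 * T) + n * (2 * S) := Nat.add_le_add hXv_card hYv_card
      _ = n * (1056 * T + 2 * S) := by ring
      _ < n * (2 * n) := Nat.mul_lt_mul_of_pos_left (by omega) hnpos
      _ = (univ : Finset (Fin (2 * n) × Fin n)).card := by simp [mul_comm]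
  simp only [hXv, hYv, mem_union, mem_filter, mem_univ, true_and, not_or] at hxv
  obtain ⟨⟨⟨hv_bad, hv_row⟩, hv_col⟩, hv_img⟩ := hxv
  have hv_good : (F (ev xv)).card ≤ S := notBad hv_bad
  ---------------------------------------------------------------- Step 3: the hub `w`
  let ew : Fin n × Fin (2 * n) → Fin N × Fin N := fun x => (hi x.1, mid x.2)
  have ew_inj : Function.Injective ew := fun x y e => by
    simp only [ew, Prod.mk.injEq] at e
    exact Prod.ext (hi_inj e.1) (mid_inj e.2)
  set Xw : Finset (Fin n × Fin (2 * n)) :=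
    univ.filter fun x => ew x ∈ Urow (eu xu).1 ∪ Ucol c0 ∪ Ucol (ev xv).2 with hXw
  set Yw : Finset (Fin n × Fin (2 * n)) :=
    univ.filter fun x => hi x.1 ∈ (F (eu xu)).image Prod.fst ∪ (F (ev xv)).image Prod.fst
    with hYw
  have hXw_card : Xw.card ≤ n * (48 * T) :=
    calc Xw.card ≤ (Urow (eu xu).1 ∪ Ucol c0 ∪ Ucol (ev xv).2).card := cnt ew ew_inj _
      _ ≤ (Urow (eu xu).1).card + (Ucol c0).card + (Ucol (ev xv).2).card :=
          (card_union_le _ _).trans (Nat.add_le_add_right (card_union_le _ _) _)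
      _ ≤ 16 * n * T + 16 * n * T + 16 * n * T :=
          Nat.add_le_add (Nat.add_le_add (hUrow_card _) (hUcol_card _)) (hUcol_card _)
      _ = n * (48 * T) := by ring
  have hYw_card : Yw.card ≤ n * (4 * S) := by
    have hprod : Yw = (univ.filter fun i : Fin n =>
        hi i ∈ (F (eu xu)).image Prod.fst ∪ (F (ev xv)).image Prod.fst) ×ˢ
        (univ : Finset (Fin (2 * n))) := by
      ext x
      simp [hYw]
    rw [hprod, card_product, card_univ, Fintype.card_fin]
    calc (univ.filter fun i : Fin n =>
            hi i ∈ (F (eu xu)).image Prod.fst ∪ (F (ev xv)).image Prod.fst).card * (2 * n)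
        ≤ ((F (eu xu)).image Prod.fst ∪ (F (ev xv)).image Prod.fst).card * (2 * n) :=
          Nat.mul_le_mul_right _ (cnt' hi hi_inj _)
      _ ≤ (((F (eu xu)).image Prod.fst).card + ((F (ev xv)).image Prod.fst).card) * (2 * n) :=
          Nat.mul_le_mul_right _ (card_union_le _ _)
      _ ≤ ((F (eu xu)).card + (F (ev xv)).card) * (2 * n) :=
          Nat.mul_le_mul_right _ (Nat.add_le_add card_image_le card_image_le)
      _ ≤ (S + S) * (2 * n) := Nat.mul_le_mul_right _ (Nat.add_le_add hu_good hv_good)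
      _ = n * (4 * S) := by ring
  obtain ⟨xw, -, hxw⟩ : ∃ x ∈ (univ : Finset (Fin n × Fin (2 * n))), x ∉ Xw ∪ Yw := by
    apply exists_mem_notMem_of_card_lt_card
    calc (Xw ∪ Yw).card ≤ Xw.card + Yw.card := card_union_le _ _
      _ ≤ n * (48 * T) + n * (4 * S) := Nat.add_le_add hXw_card hYw_card
      _ = n * (48 * T + 4 * S) := by ring
      _ < n * (2 * n) := Nat.mul_lt_mul_of_pos_left (by omega) hnpos
      _ = (univ : Finset (Fin n × Fin (2 * n))).card := by simp
  simp only [hXw, hYw, mem_union, mem_filter, mem_univ, true_and, not_or] at hxw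
  obtain ⟨⟨⟨hw_row, hw_col⟩, hw_col'⟩, hw_img, hw_img'⟩ := hxw
  ---------------------------------------------------------------- Conclusion
  refine ⟨eu xu, ev xv, ew xw, ?_, ?_, ?_, ?_, ?_, ?_⟩
  · have := xu.1.isLt; have := xu.2.isLt
    simp only [eu, lo, mid]; omega
  · have := xv.1.isLt; have := xv.2.isLt
    simp only [ev, mid, hi]; omega
  · have := xw.1.isLt; have := xw.2.isLt
    simp only [ew, hi, mid]; omega
  · intro j hj
    rcases hj with hj | hj
    · exact ⟨notUrow hv_row j hj, notUrow hw_row j hj⟩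
    · have hj' : j.2 = c0 := Fin.ext hj
      exact ⟨notUcol hv_col j hj', notUcol hw_col j hj'⟩
  · intro j hj
    refine ⟨fun hm => hv_img ?_, notUcol hw_col' j hj⟩
    exact mem_image.mpr ⟨j, memF hm, hj⟩
  · intro j hj
    refine ⟨fun hm => hw_img ?_, fun hm => hw_img' ?_⟩
    · exact mem_image.mpr ⟨j, memF hm, hj⟩
    · exact mem_image.mpr ⟨j, memF hm, hj⟩

end Counting

/-! ### Assembly -/

/-- In `Fin 3`, the two elements different from `0`. [folklore] -/
theorem Fin3.eq_of_ne_zero : ∀ a : Fin 3, a ≠ 0 → a = 1 ∨ a = 2 := by decide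
/-- In `Fin 3`, the two elements different from `1`. [folklore] -/
theorem Fin3.eq_of_ne_one : ∀ a : Fin 3, a ≠ 1 → a = 0 ∨ a = 2 := by decide
/-- In `Fin 3`, the two elements different from `2`. [folklore] -/
theorem Fin3.eq_of_ne_two : ∀ a : Fin 3, a ≠ 2 → a = 0 ∨ a = 1 := by decide

/-- **Bravyi–Gosset–König, Theorem 2** (classical logarithmic depth lower bound for 2D HLF),
discharging the named fact `hlf_classical_depth_lower_bound`: with `c = 1/2` and `N₀ = 2³⁰`,
every classical probabilistic circuit of fan-in `≤ 2` gates that outputs a solution of the 2D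
Hidden Linear Function problem with probability `> 7/8` on every valid instance of grid size
`N ≥ N₀` has depth `≥ c log N`. [cite: BravyiGossetKonigScience2018, Theorem 2] -/
theorem hlf_classical_depth_lower_bound_holds : hlf_classical_depth_lower_bound := by
  classical
  refine ⟨1 / 2, by norm_num, 2 ^ 30, ?_⟩
  intro N hN r Cs hB hsucc
  have hNpos : 0 < N := lt_of_lt_of_le (by norm_num) hN
  set D : ℕ := univ.sup fun v => (Cs v).depth with hD_def
  have hdepth : ∀ v, (Cs v).depth ≤ D := fun v => le_sup (f := fun v => (Cs v).depth) (mem_univ v)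
  -- the hub bits read by each output
  set LCb : Fin N × Fin N → Finset (Fin N × Fin N) :=
    fun j => univ.filter fun h => bIdx N r h ∈ (Cs j).lightCone with hLCb
  have memLCb : ∀ {h j}, bIdx N r h ∈ (Cs j).lightCone → h ∈ LCb j := fun hm => by
    simp [hLCb, hm]
  have hT : ∀ j, (LCb j).card ≤ 2 ^ D := by
    intro j
    calc (LCb j).card ≤ (Cs j).lightCone.card :=
          card_le_card_of_injOn (bIdx N r) (fun h hh => by simpa [hLCb] using hh)
            (bIdx_injective N r).injOn
      _ ≤ 2 ^ (Cs j).depth := (Cs j).card_lightCone_le_two_pow (hB j)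
      _ ≤ 2 ^ D := Nat.pow_le_pow_right (by norm_num) (hdepth j)
  -- the combinatorial heart: shallow circuits fail on some rectangle instance
  have hsmall : N / 8 < 2048 * 2 ^ D := by
    by_contra hcon
    push Not at hcon
    obtain ⟨u, v, w, hu, hv, hw, L0, L1, L2⟩ := exists_hubs LCb hT (by positivity) hcon
    obtain ⟨R, hr1, hc1, hc2, hr2, hhub0, hhub1, hhub2⟩ :=
      RectData.exists_of_hubs (n := N / 8) u v w hu hv hw
    -- a random string good for all eight settings
    have h8 : (1 - 1 / Fintype.card (Fin 3 → Bool) : ℝ) = 7 / 8 := by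
      simp only [Fintype.card_fun, Fintype.card_bool, Fintype.card_fin]; norm_num
    obtain ⟨ρ, hρ⟩ := exists_coins_forall (r := r)
      (fun β => {ρ : List Bool | (fun v => (Cs v).eval
        (Fin.append (encodeHLF (R.necklace.hlfInstance β)) fun i => ρ.getD i false)) ∈
          hlfSolutions (R.necklace.hlfInstance β)})
      (fun β => by rw [h8]; exact hsucc _ (Necklace.hlfInstance_isValid β))
    -- the game is lost for this string
    obtain ⟨β, hβ⟩ := necklace_game_lost R.necklace R.zone R.zone_ne_arcOf Cs
      (fun i => ρ.toList.getD i false) (by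
        intro p a ha hm
        have hm' := memLCb hm
        simp only [RectData.necklace_toFun, RectData.necklace_hub] at hm'
        rcases R.zone_spec p with ⟨hz, hl⟩ | ⟨hz, hl⟩ | ⟨hz, hl⟩
        · rw [hz] at ha
          have hj : (R.toFun p).1 = u.1 ∨ (R.toFun p).2.val = 0 := by
            rcases hl with hl | hl
            · exact Or.inl (Fin.ext (hl.trans hr1))
            · exact Or.inr (hl.trans hc1)
          rcases Fin3.eq_of_ne_zero a ha with rfl | rfl
          · rw [hhub1] at hm'; exact (L0 _ hj).1 hm'
          · rw [hhub2] at hm'; exact (L0 _ hj).2 hm'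
        · rw [hz] at ha
          have hj : (R.toFun p).2 = v.2 := Fin.ext (hl.trans hc2)
          rcases Fin3.eq_of_ne_one a ha with rfl | rfl
          · rw [hhub0] at hm'; exact (L1 _ hj).1 hm'
          · rw [hhub2] at hm'; exact (L1 _ hj).2 hm'
        · rw [hz] at ha
          have hj : (R.toFun p).1 = w.1 := Fin.ext (hl.trans hr2)
          rcases Fin3.eq_of_ne_two a ha with rfl | rfl
          · rw [hhub0] at hm'; exact (L2 _ hj).1 hm'
          · rw [hhub1] at hm'; exact (L2 _ hj).2 hm')
    exact hβ (hρ β)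
  -- arithmetic: D ≥ log₂ N - 14 ≥ ½ log N
  have hlog : Nat.log 2 N < D + 15 := by
    have h1 : 2 ^ Nat.log 2 N ≤ N := Nat.pow_log_le_self 2 hNpos.ne'
    have h2 : N < 2 ^ (D + 15) := by
      have h3 : 1 ≤ 2 ^ D := Nat.one_le_two_pow
      have h4 : 2 ^ (D + 15) = 2 ^ D * 32768 := by rw [pow_add]; norm_num
      rw [h4]
      generalize 2 ^ D = T at hsmall h3
      omega
    exact (Nat.pow_lt_pow_iff_right (by norm_num)).mp (h1.trans_lt h2)
  have hL30 : 30 ≤ Nat.log 2 N := Nat.le_log_of_pow_le (by norm_num) hN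
  have hDge : ((Nat.log 2 N : ℕ) : ℝ) + 1 ≤ 2 * D := by
    have : Nat.log 2 N + 1 ≤ 2 * D := by omega
    exact_mod_cast this
  have hlogN : Real.log N ≤ (Nat.log 2 N : ℕ) + 1 := by
    have h3 : (N : ℝ) < 2 ^ (Nat.log 2 N + 1) := by
      exact_mod_cast Nat.lt_pow_succ_log_self one_lt_two N
    have h4 : Real.log N < ((Nat.log 2 N + 1 : ℕ) : ℝ) * Real.log 2 := by
      rw [← Real.log_pow]
      exact Real.log_lt_log (by exact_mod_cast hNpos) (by exact_mod_cast h3)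
    have h5 : Real.log 2 ≤ 1 := by
      have := Real.log_le_sub_one_of_pos (zero_lt_two' ℝ); linarith
    have h6 : ((Nat.log 2 N + 1 : ℕ) : ℝ) * Real.log 2 ≤ ((Nat.log 2 N + 1 : ℕ) : ℝ) :=
      mul_le_of_le_one_right (by positivity) h5
    push_cast at h4 h6 ⊢
    linarith
  -- conclusion
  haveI : Nonempty (Fin N × Fin N) := ⟨(⟨0, hNpos⟩, ⟨0, hNpos⟩)⟩
  obtain ⟨v₀, -, hv₀⟩ :=
    exists_mem_eq_sup (univ : Finset (Fin N × Fin N)) univ_nonempty fun v => (Cs v).depth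
  calc 1 / 2 * Real.log N ≤ D := by linarith
    _ = ((Cs v₀).depth : ℝ) := by rw [hD_def, hv₀]
    _ ≤ ⨆ v, ((Cs v).depth : ℝ) :=
        le_ciSup (f := fun v => ((Cs v).depth : ℝ)) (Set.finite_range _).bddAbove v₀

end Literature.Computability.QuantumComplexity
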